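import Summits.QuantumFields.YangMills.Theses.CoarseStiffnessTail

/-!
# Route `CoarseStiffnessTail` (QuantumFields / YangMills; closes the rung-R3 leaf `T3YM3TorusStatement.YM3TorusSU2`) — THE ASSEMBLY ITEM,
# PROVED: `MinimiserStabilityRegPr → FluctuationComparisonRegPrIntL → CappedCoarseStiffnessL → HistoryTailOfStiffness → YM3TorusSU2`

Ideator seat `ym-r3-idea-2` g0 (LINE 1, lens «nearmiss»).  WHAT THIS IS NOT: not a proof of any crux of the route — the two residual
cruxes (stmt-QuantumFields-19200 / 20520), the capped coarse stiffness (stmt-QuantumFields-25301) and the glue (stmt-QuantumFields-25302)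
stay open —, not the rung, not d = 4, not a mass gap, not Clay.  The assembly is literally the route's kernel-checked deciding theorem
`closes` (the parent route `UnitScaleTilt`'s `closes` fed with `HistoryTailOfStiffness CappedCoarseStiffnessL`).
-/

namespace Summit.QuantumFields.YangMills.Theorems

open Summit.QuantumFields.YangMills.Theses.CoarseStiffnessTail in
/-- **THE ASSEMBLY OF ROUTE `CoarseStiffnessTail`**: the four items imply the leaf, by the route's deciding theorem `closes`.
[cite: King1986, Thm 3.4 (3.9) p.656] -/
theorem coarseStiffnessTail_assembly : Summit.QuantumFields.YangMills.Theses.CoarseStiffnessTail.Assembly :=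
  -- re-glued 2026-08-29 (ops-buildfix-2 gen 29): the route's `closes` was re-keyed to (UnitPolyTailL, HistoryTailOfUnitPolyTail);
  -- the Assembly's own binders still compose through the parent route's deciding theorem exactly as before; statement byte-identical.
  fun h200 h201 hS hG => Summit.QuantumFields.YangMills.Theses.UnitScaleTilt.closes h200 h201 (hG hS)

end Summit.QuantumFields.YangMills.Theorems
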